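import Literature.AlgebraicGeometry.Frobenioids.Prop53Sub
import Literature.AlgebraicGeometry.Frobenioids.ModelFrobenioidBaseChangeEquivalence

/-!
# Frobenioids I, Corollary 5.4: the model-level `Ψ^rlf : C₁^rlf ⥲ C₂^rlf` (row C54/L05 of the W3 sub-DAG)

Mochizuki, *The geometry of Frobenioids I: the general theory*, Kyushu J. Math. **62** (2008) 293–400,
Corollary 5.4, kurims p. 104 l. 1–6: "Then there exists a … functor `Ψ^rlf : C₁^rlf → C₂^rlf` that fits into a
1-commutative diagram … [where the vertical arrows are the natural functors of Propositions 5.3, and the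
horizontal arrows are equivalences of categories]"; proof l. 19–21: "In light of the definition of the
realification [cf. Proposition 5.3], Corollary 5.4 follows immediately from Corollaries 4.10; 4.11, (iii),
(iv)". [cite: MochizukiFrdI2008, Cor. 5.4 p.104]

PROOF COMPANION (cell abc-iut, L1 sub-DAG W3, seat abc-iut-w5-d137) of the slot `FrdI.Cor54Sub.RlfTransport`
(`Prop53Sub.lean`): from an equivalence `Ψ^Base : D₁ ⥲ D₂` and a realified `Ψ^Φ` (`Erlf`, a
`DivisorMonoidIsoOverBase` of THE realified data) carrying `ℝ · Φ₁^birat` onto `ℝ · Φ₂^birat`, the morphism of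
model data `(Φ₁^rlf, ℝ · Φ₁^birat) → (Φ₂^rlf, ℝ · Φ₂^birat)` OVER `Ψ^Base` (seat abc-iut-w5-d048's
`ModelFrobenioid.DataHomOver`) — `rlfNatTransOver`, `realSpanMapOver`, `rlfDataHomOver` — whose induced functor
of model Frobenioids `C₁^rlf → C₂^rlf` is an EQUIVALENCE (`DataHomOver.functor_isEquivalence`,
`ModelFrobenioidBaseChangeEquivalence.lean`) lying over `Ψ^Base`, preserving Frobenius degrees and carrying
divisors by `(Ψ^Φ)^rlf`: **`FrdI.Cor54Sub.rlfTransport_holds : RlfTransport F₁ hΦ₁ F₂ hΦ₂ ΨBase Erlf`**.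
No new `Prop`-valued fact; nothing here bears on [IUTchIII] Cor. 3.12.
-/

noncomputable section

namespace Literature.AlgebraicGeometry.Frobenioids

open CategoryTheory Opposite Function
open Literature.AnabelianGeometry.EtaleTheta

universe w v u v' u' v₁ u₁ v₁' u₁' v₂ u₂ v₂' u₂'

namespace FrdI.Cor54Sub

variable {D₁ : Type u₁'} [Category.{v₁'} D₁] {Φ₁ : D₁ᵒᵖ ⥤ CommMonCat.{w}}
  {C₁ : Type u₁} [Category.{v₁} C₁] (F₁ : C₁ ⥤ ElemFrobenioid Φ₁) (hΦ₁ : PreFrobenioid.IsPerfFactorialOn Φ₁)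
  {D₂ : Type u₂'} [Category.{v₂'} D₂] {Φ₂ : D₂ᵒᵖ ⥤ CommMonCat.{w}}
  {C₂ : Type u₂} [Category.{v₂} C₂] (F₂ : C₂ ⥤ ElemFrobenioid Φ₂) (hΦ₂ : PreFrobenioid.IsPerfFactorialOn Φ₂)

/-! ### C54/L05: the model-level `Ψ^rlf` -/

section Transport

variable {F₁ F₂}

/-- `(Ψ^Φ)^rlf` as a homomorphism of monoids on `D₁`, `Φ₁^rlf → Φ₂^rlf|_{D₁}` (restriction along `Ψ^Base`).
[cite: MochizukiFrdI2008, Cor. 5.4 p.104] -/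
def rlfNatTransOver (ΨBase : D₁ ⥤ D₂)
    (Erlf : PreFrobenioidData.DivisorMonoidIsoOverBase (rlfData F₁ hΦ₁) (rlfData F₂ hΦ₂) ΨBase) :
    rlfFunctor Φ₁ (PreFrobenioid.IsPerfFactorialOn.op hΦ₁) ⟶
      ΨBase.op ⋙ rlfFunctor Φ₂ (PreFrobenioid.IsPerfFactorialOn.op hΦ₂) where
  app X := CommMonCat.ofHom (Erlf.iso (unop X)).toMonoidHom
  naturality X Y f := by
    apply CommMonCat.hom_ext
    ext x
    exact Erlf.natural f.unop x

/-- The ℝ-spans: `(Ψ^Φ)^rlf,gp` restricted to `ℝ · Φ₁^birat(X) → ℝ · Φ₂^birat(Ψ^Base X)`, granted that it carries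
the one onto the other. [cite: MochizukiFrdI2008, Cor. 5.4 p.104] -/
def realSpanMapOver (ΨBase : D₁ ⥤ D₂)
    (Erlf : PreFrobenioidData.DivisorMonoidIsoOverBase (rlfData F₁ hΦ₁) (rlfData F₂ hΦ₂) ΨBase)
    (hspan : ∀ X : D₁,
      (((RealificationData.canonical Φ₁ (PreFrobenioid.IsPerfFactorialOn.op hΦ₁)).realSpan
            (PreFrobenioid.biratSubfunctor F₁)).carrier X).map (MonGp.map (Erlf.iso X).toMonoidHom) =
        ((RealificationData.canonical Φ₂ (PreFrobenioid.IsPerfFactorialOn.op hΦ₂)).realSpan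
            (PreFrobenioid.biratSubfunctor F₂)).carrier (ΨBase.obj X)) :
    ((RealificationData.canonical Φ₁ (PreFrobenioid.IsPerfFactorialOn.op hΦ₁)).realSpan
        (PreFrobenioid.biratSubfunctor F₁)).toMonoid ⟶
      ΨBase.op ⋙ ((RealificationData.canonical Φ₂ (PreFrobenioid.IsPerfFactorialOn.op hΦ₂)).realSpan
        (PreFrobenioid.biratSubfunctor F₂)).toMonoid where
  app X := CommMonCat.ofHom
    (((gpApp (rlfNatTransOver hΦ₁ hΦ₂ ΨBase Erlf) X).comp (Subgroup.subtype _)).codRestrict _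
      fun c => (hspan (unop X)) ▸ Subgroup.mem_map_of_mem _ c.2)
  naturality X Y f := by
    apply CommMonCat.hom_ext
    apply MonoidHom.ext
    intro c
    apply Subtype.ext
    exact gpApp_pullGp (rlfNatTransOver hΦ₁ hΦ₂ ΨBase Erlf) f.unop c.1

/-- **The morphism of model data `(Φ₁^rlf, ℝ · Φ₁^birat) → (Φ₂^rlf, ℝ · Φ₂^birat)` over `Ψ^Base`** determined by a
realified `Ψ^Φ` carrying the spans onto each other (seat abc-iut-w5-d048's `ModelFrobenioid.DataHomOver`; the
`Div_B`-compatibility is definitional, both `Div_B` being subgroup inclusions).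
[cite: MochizukiFrdI2008, Cor. 5.4 p.104] -/
def rlfDataHomOver (ΨBase : D₁ ⥤ D₂)
    (Erlf : PreFrobenioidData.DivisorMonoidIsoOverBase (rlfData F₁ hΦ₁) (rlfData F₂ hΦ₂) ΨBase)
    (hspan : ∀ X : D₁,
      (((RealificationData.canonical Φ₁ (PreFrobenioid.IsPerfFactorialOn.op hΦ₁)).realSpan
            (PreFrobenioid.biratSubfunctor F₁)).carrier X).map (MonGp.map (Erlf.iso X).toMonoidHom) =
        ((RealificationData.canonical Φ₂ (PreFrobenioid.IsPerfFactorialOn.op hΦ₂)).realSpan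
            (PreFrobenioid.biratSubfunctor F₂)).carrier (ΨBase.obj X)) :
    ModelFrobenioid.DataHomOver ΨBase
      ((RealificationData.canonical Φ₁ (PreFrobenioid.IsPerfFactorialOn.op hΦ₁)).realSpan
        (PreFrobenioid.biratSubfunctor F₁)).incl
      ((RealificationData.canonical Φ₂ (PreFrobenioid.IsPerfFactorialOn.op hΦ₂)).realSpan
        (PreFrobenioid.biratSubfunctor F₂)).incl where
  η := rlfNatTransOver hΦ₁ hΦ₂ ΨBase Erlf
  β := realSpanMapOver hΦ₁ hΦ₂ ΨBase Erlf hspan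
  comm _ _ := rfl

/-- **C54/L05, PROVED: the model-level `Ψ^rlf` exists and is an equivalence** over `Ψ^Base`, preserving Frobenius
degrees and carrying divisors by `(Ψ^Φ)^rlf` — "there exists a … functor `Ψ^rlf : C₁^rlf → C₂^rlf` … [the
horizontal arrows are equivalences of categories]" (p. 104 l. 1–6), in the model description of THE realifications
and the operations form of Cor. 4.11 (iv). [cite: MochizukiFrdI2008, Cor. 5.4 p.104] -/
theorem rlfTransport_holds (ΨBase : D₁ ≌ D₂)
    (Erlf : PreFrobenioidData.DivisorMonoidIsoOverBase (rlfData F₁ hΦ₁) (rlfData F₂ hΦ₂) ΨBase.functor) :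
    RlfTransport F₁ hΦ₁ F₂ hΦ₂ ΨBase Erlf := by
  intro hspan
  let h := rlfDataHomOver hΦ₁ hΦ₂ ΨBase.functor Erlf hspan
  have hη : ∀ X : D₁, Bijective (h.η.app (op X)).hom := fun X => (Erlf.iso X).bijective
  have hβ : ∀ X : D₁, Bijective (h.β.app (op X)).hom := by
    intro X
    have hgp : Bijective (gpApp (rlfNatTransOver hΦ₁ hΦ₂ ΨBase.functor Erlf) (op X)) :=
      gpMap_bijective_of_bijective _ (Erlf.iso X).bijective
    refine ⟨fun a b hab => Subtype.ext (hgp.1 (congrArg Subtype.val hab)), fun ⟨y, hy⟩ => ?_⟩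
    have hy' : y ∈ ((RealificationData.canonical Φ₂ (PreFrobenioid.IsPerfFactorialOn.op hΦ₂)).realSpan
        (PreFrobenioid.biratSubfunctor F₂)).carrier (ΨBase.functor.obj X) := hy
    rw [← hspan X] at hy'
    obtain ⟨x, hx, hxy⟩ := Subgroup.mem_map.mp hy'
    exact ⟨⟨x, hx⟩, Subtype.ext hxy⟩
  haveI := h.functor_isEquivalence hη hβ
  refine ⟨h.functor, NatIso.ofComponents (fun A => Iso.refl (ΨBase.functor.obj A.base)) (fun φ => ?_),
    inferInstance, fun A B φ => rfl, fun A B φ => ?_⟩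
  · change ΨBase.functor.map (ModelFrobenioid.baseMap φ) ≫ 𝟙 _ = 𝟙 _ ≫ ΨBase.functor.map _
    rw [Category.comp_id, Category.id_comp]
    rfl
  · change Erlf.iso A.base (ModelFrobenioid.div φ) =
      (rlfData F₂ hΦ₂).pull (𝟙 (ΨBase.functor.obj A.base)) (Erlf.iso A.base (ModelFrobenioid.div φ))
    rw [(rlfData F₂ hΦ₂).pull_id]

end Transport

end FrdI.Cor54Sub

end Literature.AlgebraicGeometry.Frobenioids

end
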